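import Mathlib.GroupTheory.Archimedean
import Mathlib.GroupTheory.SpecificGroups.Cyclic.Basic
import Mathlib.Algebra.Group.Subgroup.ZPowers.Lemmas
import Mathlib.Algebra.Group.Subgroup.Map
import HarnessLib

/-!
# Brick (b), local atom — FILE C input (C-β), GROUP FORM: SUBGROUPS OF A GROUP LYING INSIDE THE CLOSURE OF TWO COMMUTING
# ELEMENTS ARE GENERATED BY TWO COMMUTING ELEMENTS, WITH THE TRANSPORTS THE ASSEMBLER CONSUMES — `D_w ≅ Stab(w) ≤ ⟨γ̄₁, γ̄₂⟩ ⟹ D_w = ⟨σ⟩·⟨τ⟩`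

Cell `bsd-print-cf2` (HOME `run/shared/lean/pub/bsd-print-cf2/`), width seat `bsd-line-cf2-p1-w7` g10 (width copy «width 7»,
explicit-unit, no item claim), for the LAST registered content stub `stub_localAtom` of the deciding class door
stmt-BirchSwinnertonDyer-23300 (crux of record 24721 / 20368). COMPANION of -w8 g8's `…LeopoldtUnitsTwoGenerated`
(`UnitsFGLayerBound.exists_two_generators_of_subgroup`, stated for a `CommGroup H` all of whose elements are `g₁^i g₂^j`), written
to the binder shapes the (C-γ3) assembler (-w5 g12, STATUS 2026-08-29T21:41:24Z «GO -w7 append») and the local bound B3c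
(cf2c-w5 g12 `LeopoldtAtV.exists_cover_units_of_bicyclic … (σ τ : L ≃ₐ[L₀] L) (hστ : σ * τ = τ * σ) (hgen : ∀ g, ∃ i j : ℤ, g = σ ^ i * τ ^ j)`)
actually consume: (i) a plain `[Group G]` with `Commute g₁ g₂` (or the mixin `[IsMulCommutative G]` that Mathlib's `IsAbelianGalois`
provides for `F ≃ₐ[K] F` — no `CommGroup` instance to conjure) and the hypothesis `H ≤ Subgroup.closure {g₁, g₂}` (so
`Stab(w) ≤ Gal(F_n/K₀)` with `Gal(F_n/K₀) ≤ ⟨γ̄₁⁻¹, γ̄₂⁻¹⟩` works as is); (ii) the TRANSPORT through an injective homomorphism /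
a subgroup-as-a-type / a surjection / a `MulEquiv` — the shape `e : ↥Stab(w) ≃* Gal((F_n)_w/(K₀)_{w₀})` of the places packet
(`SemiLocal.decompMulEquiv`, ty2's `toSemiLocalTower_map_apply_eq_decompMulEquiv`); (iii) the element forms `g = σ^i τ^j` (`ℤ`- and,
in a finite group, `ℕ`-exponents) = B3c's `hgen` VERBATIM, and `σ^{[D : ⟨τ⟩]} ∈ ⟨τ⟩` (the devissage's `hσ`). The two-generator
theorem itself is re-proved here in the group form (`τ` generates `H ∩ ⟨g₂⟩` by `Subgroup.le_zpowers_iff`, `σ = g₁^d g₂^e` with `dℤ`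
the subgroup of first exponents, `Int.subgroup_cyclic`) so that this file imports Mathlib only. THESES-FREE; theorems only
(no `def`, no named fact, no `sorry`).

HONEST FRAMING: elementary group theory (subgroups of `ℤ²`, two-generator case); nothing here closes 23300 / 24721 / 20368;
BSD is not proved by any of this.

## References
* [Rubin1991] K. Rubin, Invent. Math. 103 (1991) 25–68, §4 p. 36–37 (`𝒢 = Gal(K_∞/K) ≅ ℤ_p²`, topological generators `γ₁, γ₂`).
* [deShalit1987] E. de Shalit, *Iwasawa theory of elliptic curves with complex multiplication*, II.4.17 (the two-variable tower).
* [SerreLocalFields1979] J.-P. Serre, *Local Fields*, GTM 67, Ch. I §7 (decomposition groups).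
* S. Lang, *Algebra*, I §8 (subgroups of free abelian groups of rank 2). [folklore]
-/

set_option linter.dupNamespace false -- D-0017: single-problem summit, `…BirchSwinnertonDyer.BirchSwinnertonDyer…` repeats a namespace by design
set_option autoImplicit false

namespace Summit.BirchSwinnertonDyer.BirchSwinnertonDyer.Theorems.PrintCf2.LeopoldtAtV.TwoGenerated

variable {G : Type*} [Group G]

/-! ### §1. Elements of the closure of a commuting pair -/

/-- **`⟨g₁, g₂⟩ = {g₁^m g₂^n}` for commuting `g₁, g₂`** (Mathlib's `Subgroup.mem_closure_pair` for a `CommGroup`, here in an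
arbitrary group under `Commute g₁ g₂`). [folklore] -/
theorem mem_closure_pair_iff_of_commute {g₁ g₂ : G} (h12 : Commute g₁ g₂) {z : G} :
    z ∈ Subgroup.closure ({g₁, g₂} : Set G) ↔ ∃ m n : ℤ, g₁ ^ m * g₂ ^ n = z := by
  constructor
  · intro hz
    refine Subgroup.closure_induction ?_ ?_ ?_ ?_ hz
    · rintro x (rfl | rfl)
      · exact ⟨1, 0, by simp⟩
      · exact ⟨0, 1, by simp⟩
    · exact ⟨0, 0, by simp⟩
    · rintro x y _ _ ⟨m, n, rfl⟩ ⟨m', n', rfl⟩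
      refine ⟨m + m', n + n', ?_⟩
      rw [zpow_add, zpow_add, mul_assoc, ← mul_assoc (g₁ ^ m'), (h12.zpow_zpow m' n).eq]
      simp only [mul_assoc]
    · rintro x _ ⟨m, n, rfl⟩
      refine ⟨-m, -n, ?_⟩
      rw [mul_inv_rev, zpow_neg, zpow_neg, (h12.zpow_zpow m n).inv_inv.eq]
  · rintro ⟨m, n, rfl⟩
    exact mul_mem (Subgroup.zpow_mem _ (Subgroup.subset_closure (by simp)) m)
      (Subgroup.zpow_mem _ (Subgroup.subset_closure (by simp)) n)

/-- The closure of a commuting pair is commutative: any two of its elements commute. [folklore] -/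
theorem commute_of_mem_closure_pair {g₁ g₂ : G} (h12 : Commute g₁ g₂) {x y : G}
    (hx : x ∈ Subgroup.closure ({g₁, g₂} : Set G)) (hy : y ∈ Subgroup.closure ({g₁, g₂} : Set G)) : Commute x y := by
  obtain ⟨m, n, rfl⟩ := (mem_closure_pair_iff_of_commute h12).1 hx
  obtain ⟨m', n', rfl⟩ := (mem_closure_pair_iff_of_commute h12).1 hy
  exact ((((Commute.refl g₁).zpow_zpow m m').mul_right (h12.zpow_zpow m n')).mul_left
    (((h12.zpow_zpow m' n).symm).mul_right ((Commute.refl g₂).zpow_zpow n n')))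

/-- **`ℕ`-exponent form in a finite group**: for commuting `g₁, g₂` of a finite group, `⟨g₁, g₂⟩ = {g₁^a g₂^b : a, b ∈ ℕ}` (the shape
the norm operators `Σ_{k<m} σ^k` of the local devissage want). [folklore] -/
theorem mem_closure_pair_iff_of_commute_of_finite [Finite G] {g₁ g₂ : G} (h12 : Commute g₁ g₂) {z : G} :
    z ∈ Subgroup.closure ({g₁, g₂} : Set G) ↔ ∃ a b : ℕ, g₁ ^ a * g₂ ^ b = z := by
  rw [mem_closure_pair_iff_of_commute h12]
  constructor
  · rintro ⟨m, n, rfl⟩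
    obtain ⟨a, ha⟩ := (Submonoid.mem_powers_iff _ _).1 ((mem_powers_iff_mem_zpowers).2 (Subgroup.zpow_mem_zpowers g₁ m))
    obtain ⟨b, hb⟩ := (Submonoid.mem_powers_iff _ _).1 ((mem_powers_iff_mem_zpowers).2 (Subgroup.zpow_mem_zpowers g₂ n))
    exact ⟨a, b, by rw [ha, hb]⟩
  · rintro ⟨a, b, rfl⟩
    exact ⟨a, b, by rw [zpow_natCast, zpow_natCast]⟩

/-! ### §2. The two-generator theorem -/

/-- **Every subgroup `H ≤ ⟨g₁, g₂⟩` (commuting `g₁, g₂`) is `⟨σ, τ⟩` for commuting `σ, τ ∈ H`** — `τ` a generator of the cyclic group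
`H ∩ ⟨g₂⟩` (`Subgroup.le_zpowers_iff`), `σ = g₁^d g₂^e ∈ H` where `d` generates the subgroup `{m ∈ ℤ : ∃ n, g₁^m g₂^n ∈ H}` of `ℤ`
(`Int.subgroup_cyclic`); then `h = g₁^{jd} g₂^n ∈ H` gives `σ^{-j} h ∈ H ∩ ⟨g₂⟩ = ⟨τ⟩`. [folklore] -/
theorem exists_closure_pair_eq_of_le_closure_pair {g₁ g₂ : G} (h12 : Commute g₁ g₂) (H : Subgroup G)
    (hH : H ≤ Subgroup.closure ({g₁, g₂} : Set G)) :
    ∃ σ τ : G, σ ∈ H ∧ τ ∈ H ∧ Commute σ τ ∧ Subgroup.closure ({σ, τ} : Set G) = H := by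
  classical
  -- Step 1: `τ = g₂ ^ k` generates the cyclic group `H ⊓ ⟨g₂⟩`
  obtain ⟨k, hk⟩ := (Subgroup.le_zpowers_iff g₂ (H ⊓ Subgroup.zpowers g₂)).1 inf_le_right
  have hτH : g₂ ^ k ∈ H := by
    have hmem : g₂ ^ k ∈ H ⊓ Subgroup.zpowers g₂ := by rw [hk]; exact Subgroup.mem_zpowers _
    exact (Subgroup.mem_inf.1 hmem).1
  -- Step 2: the subgroup of `ℤ` of first exponents occurring in `H`
  let S : AddSubgroup ℤ :=
    { carrier := {m | ∃ n : ℤ, g₁ ^ m * g₂ ^ n ∈ H}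
      zero_mem' := ⟨0, by simp⟩
      add_mem' := by
        rintro m m' ⟨n, hn⟩ ⟨n', hn'⟩
        refine ⟨n + n', ?_⟩
        have hmul := H.mul_mem hn hn'
        rwa [mul_assoc, ← mul_assoc (g₂ ^ n), ← (h12.zpow_zpow m' n).eq, mul_assoc, ← mul_assoc, ← zpow_add,
          ← zpow_add] at hmul
      neg_mem' := by
        rintro m ⟨n, hn⟩
        refine ⟨-n, ?_⟩
        have hinv := H.inv_mem hn
        rwa [mul_inv_rev, ← (h12.zpow_zpow m n).inv_inv.eq, ← zpow_neg, ← zpow_neg] at hinv }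
  have hS : ∀ m : ℤ, m ∈ S ↔ ∃ n : ℤ, g₁ ^ m * g₂ ^ n ∈ H := fun _ ↦ Iff.rfl
  obtain ⟨d, hd⟩ := Int.subgroup_cyclic S
  have hdS : d ∈ S := by rw [hd]; exact AddSubgroup.subset_closure rfl
  obtain ⟨e, hσH⟩ := (hS d).1 hdS
  -- Step 3: `σ = g₁ ^ d * g₂ ^ e`, `τ = g₂ ^ k`
  have hcomm : Commute (g₁ ^ d * g₂ ^ e) (g₂ ^ k) :=
    ((h12.zpow_left d).pow_right k).mul_left (((Commute.refl g₂).zpow_left e).pow_right k)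
  refine ⟨g₁ ^ d * g₂ ^ e, g₂ ^ k, hσH, hτH, hcomm, le_antisymm ?_ fun h hh ↦ ?_⟩
  · exact (Subgroup.closure_le _).2 (by rintro x (rfl | rfl); exacts [hσH, hτH])
  · -- write `h = g₁ ^ m * g₂ ^ n` with `m = j * d`
    obtain ⟨m, n, rfl⟩ := (mem_closure_pair_iff_of_commute h12).1 (hH hh)
    have hmS : m ∈ S := (hS m).2 ⟨n, hh⟩
    rw [hd, AddSubgroup.mem_closure_singleton] at hmS
    obtain ⟨j, hj⟩ := hmS
    have e1 : d * j = m := by rw [← hj, smul_eq_mul, mul_comm]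
    have e2 : e * j + (n - j * e) = n := by ring
    have hx : (g₁ ^ d * g₂ ^ e) ^ j * g₂ ^ (n - j * e) = g₁ ^ m * g₂ ^ n := by
      rw [(h12.zpow_zpow d e).mul_zpow, ← zpow_mul, ← zpow_mul, mul_assoc, ← zpow_add, e1, e2]
    -- the correction `g₂ ^ (n - j * e)` lies in `H ⊓ ⟨g₂⟩ = ⟨τ⟩`
    have hmem2 : g₂ ^ (n - j * e) ∈ H ⊓ Subgroup.zpowers g₂ := by
      refine Subgroup.mem_inf.2 ⟨?_, Subgroup.zpow_mem_zpowers g₂ _⟩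
      have hrew : g₂ ^ (n - j * e) = ((g₁ ^ d * g₂ ^ e) ^ j)⁻¹ * (g₁ ^ m * g₂ ^ n) := by
        rw [← hx, inv_mul_cancel_left]
      rw [hrew]
      exact H.mul_mem (H.inv_mem (H.zpow_mem hσH j)) hh
    rw [hk, Subgroup.mem_zpowers_iff] at hmem2
    obtain ⟨b, hb⟩ := hmem2
    exact (mem_closure_pair_iff_of_commute hcomm).2 ⟨j, b, by rw [hb, hx]⟩

/-- **The same with `H = ⟨g₁, g₂⟩` itself allowed to be all of `G`**: if `G = ⟨g₁, g₂⟩` with `g₁, g₂` commuting, every subgroup of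
`G` is the closure of a commuting pair of its elements. [folklore] -/
theorem exists_closure_pair_eq_of_closure_pair_eq_top {g₁ g₂ : G} (h12 : Commute g₁ g₂)
    (htop : Subgroup.closure ({g₁, g₂} : Set G) = ⊤) (H : Subgroup G) :
    ∃ σ τ : G, σ ∈ H ∧ τ ∈ H ∧ Commute σ τ ∧ Subgroup.closure ({σ, τ} : Set G) = H :=
  exists_closure_pair_eq_of_le_closure_pair h12 H (by rw [htop]; exact le_top)

/-! ### §3. Transport: injective and surjective homomorphisms, subgroups as types, `MulEquiv` -/

/-- **Through an injective homomorphism**: if `f : D →* G` is injective with image inside `⟨g₁, g₂⟩` (commuting `g₁, g₂`), then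
`D = ⟨σ, τ⟩` for commuting `σ, τ ∈ D` — the shape for `D = D_w ↪ Gal(F_n/K₀) ↪ Gal(F_n/K) ⊇ ⟨γ̄₁, γ̄₂⟩`. [folklore] -/
theorem exists_closure_pair_eq_top_of_injective {D : Type*} [Group D] {g₁ g₂ : G} (h12 : Commute g₁ g₂)
    (f : D →* G) (hf : Function.Injective f) (hrange : ∀ x : D, f x ∈ Subgroup.closure ({g₁, g₂} : Set G)) :
    ∃ σ τ : D, Commute σ τ ∧ Subgroup.closure ({σ, τ} : Set D) = ⊤ := by
  obtain ⟨σ', τ', hσ', hτ', hc, hcl⟩ :=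
    exists_closure_pair_eq_of_le_closure_pair h12 f.range (by rintro _ ⟨x, rfl⟩; exact hrange x)
  obtain ⟨σ, rfl⟩ := MonoidHom.mem_range.1 hσ'
  obtain ⟨τ, rfl⟩ := MonoidHom.mem_range.1 hτ'
  refine ⟨σ, τ, ?_, ?_⟩
  · have hmul : f (σ * τ) = f (τ * σ) := by rw [map_mul, map_mul]; exact hc.eq
    exact hf hmul
  · rw [eq_top_iff]
    intro x _
    have hx : f x ∈ Subgroup.closure ({f σ, f τ} : Set G) := by rw [hcl]; exact ⟨x, rfl⟩
    rw [← Set.image_pair, ← MonoidHom.map_closure] at hx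
    obtain ⟨y, hy, hxy⟩ := Subgroup.mem_map.1 hx
    exact hf hxy ▸ hy

/-- **Subgroups as types**: every `H ≤ ⟨g₁, g₂⟩` (commuting `g₁, g₂`) is, as a group `↥H`, generated by a commuting pair.
[folklore] -/
theorem exists_closure_pair_eq_top_of_le {g₁ g₂ : G} (h12 : Commute g₁ g₂) (H : Subgroup G)
    (hH : H ≤ Subgroup.closure ({g₁, g₂} : Set G)) :
    ∃ σ τ : H, Commute σ τ ∧ Subgroup.closure ({σ, τ} : Set H) = ⊤ :=
  exists_closure_pair_eq_top_of_injective h12 H.subtype H.subtype_injective fun x ↦ hH x.2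

/-- **`⊤`-form**: if `G = ⟨g₁, g₂⟩` with `g₁, g₂` commuting, every subgroup `H` of `G` is, as a group, generated by a commuting
pair (e.g. `H = Stab(w) ≤ Gal(F_n/K₀)`). [folklore] -/
theorem exists_closure_pair_eq_top_of_closure_pair_eq_top {g₁ g₂ : G} (h12 : Commute g₁ g₂)
    (htop : Subgroup.closure ({g₁, g₂} : Set G) = ⊤) (H : Subgroup G) :
    ∃ σ τ : H, Commute σ τ ∧ Subgroup.closure ({σ, τ} : Set H) = ⊤ :=
  exists_closure_pair_eq_top_of_le h12 H (by rw [htop]; exact le_top)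

/-- **Through a surjective homomorphism**: generation by a pair passes to the image pair. [folklore] -/
theorem closure_pair_eq_top_of_surjective {D D' : Type*} [Group D] [Group D'] (f : D →* D')
    (hf : Function.Surjective f) {σ τ : D} (h : Subgroup.closure ({σ, τ} : Set D) = ⊤) :
    Subgroup.closure ({f σ, f τ} : Set D') = ⊤ := by
  rw [← Set.image_pair, ← MonoidHom.map_closure, h, Subgroup.map_top_of_surjective f hf]

/-- **Through a `MulEquiv`** (e.g. `SemiLocal.decompMulEquiv w : Stab(w) ≃* Gal(E_w/F_v)`): a commuting generating pair maps to a
commuting generating pair. [folklore] -/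
theorem exists_closure_pair_eq_top_of_mulEquiv {D D' : Type*} [Group D] [Group D'] (e : D ≃* D')
    (h : ∃ σ τ : D, Commute σ τ ∧ Subgroup.closure ({σ, τ} : Set D) = ⊤) :
    ∃ σ τ : D', Commute σ τ ∧ Subgroup.closure ({σ, τ} : Set D') = ⊤ := by
  obtain ⟨σ, τ, hc, hcl⟩ := h
  refine ⟨e σ, e τ, hc.map e, ?_⟩
  simpa using closure_pair_eq_top_of_surjective e.toMonoidHom e.surjective hcl

/-- **Composite shape for FILE C**: `D ≃* S` with `S ≤ G` a subgroup lying inside `⟨g₁, g₂⟩` (commuting) — e.g. `D = Gal(E_w/F_v)`,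
`S = Stab(w) ≤ Gal(E/F) = G`, `g_i = γ̄_i` — ⟹ `D` is generated by a commuting pair. [folklore] -/
theorem exists_closure_pair_eq_top_of_mulEquiv_of_le {D : Type*} [Group D] {g₁ g₂ : G} (h12 : Commute g₁ g₂)
    (S : Subgroup G) (hS : S ≤ Subgroup.closure ({g₁, g₂} : Set G)) (e : S ≃* D) :
    ∃ σ τ : D, Commute σ τ ∧ Subgroup.closure ({σ, τ} : Set D) = ⊤ :=
  exists_closure_pair_eq_top_of_mulEquiv e (exists_closure_pair_eq_top_of_le h12 S hS)

/-! ### §3b. The consumer's binder shape VERBATIM: `σ * τ = τ * σ` and `∀ g, ∃ i j : ℤ, g = σ ^ i * τ ^ j` -/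

/-- From a commuting generating pair to B3c's binders `(hστ : σ * τ = τ * σ) (hgen : ∀ g, ∃ i j : ℤ, g = σ ^ i * τ ^ j)`.
[folklore] -/
theorem forall_exists_eq_zpow_mul_zpow_of_closure_pair_eq_top {D : Type*} [Group D] {σ τ : D} (hc : Commute σ τ)
    (htop : Subgroup.closure ({σ, τ} : Set D) = ⊤) : σ * τ = τ * σ ∧ ∀ g : D, ∃ i j : ℤ, g = σ ^ i * τ ^ j :=
  ⟨hc.eq, fun g ↦ by
    obtain ⟨i, j, h⟩ := (mem_closure_pair_iff_of_commute hc).1 (by rw [htop]; exact Subgroup.mem_top g)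
    exact ⟨i, j, h.symm⟩⟩

/-- **Injective-homomorphism form in B3c's currency**: `f : D →* G` injective with image inside `⟨g₁, g₂⟩` (commuting) ⟹
`∃ σ τ : D, σ * τ = τ * σ ∧ ∀ g, ∃ i j : ℤ, g = σ ^ i * τ ^ j`. [folklore] -/
theorem exists_generators_of_injective {D : Type*} [Group D] {g₁ g₂ : G} (h12 : Commute g₁ g₂)
    (f : D →* G) (hf : Function.Injective f) (hrange : ∀ x : D, f x ∈ Subgroup.closure ({g₁, g₂} : Set G)) :
    ∃ σ τ : D, σ * τ = τ * σ ∧ ∀ g : D, ∃ i j : ℤ, g = σ ^ i * τ ^ j := by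
  obtain ⟨σ, τ, hc, hcl⟩ := exists_closure_pair_eq_top_of_injective h12 f hf hrange
  exact ⟨σ, τ, forall_exists_eq_zpow_mul_zpow_of_closure_pair_eq_top hc hcl⟩

/-- **Subgroup-as-a-type form in B3c's currency**: `H ≤ ⟨g₁, g₂⟩` (commuting) ⟹ `↥H` has `σ τ` with `σ * τ = τ * σ` and
`∀ g : H, ∃ i j : ℤ, g = σ ^ i * τ ^ j`. [folklore] -/
theorem exists_generators_of_le {g₁ g₂ : G} (h12 : Commute g₁ g₂) (H : Subgroup G)
    (hH : H ≤ Subgroup.closure ({g₁, g₂} : Set G)) :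
    ∃ σ τ : H, σ * τ = τ * σ ∧ ∀ g : H, ∃ i j : ℤ, g = σ ^ i * τ ^ j :=
  exists_generators_of_injective h12 H.subtype H.subtype_injective fun x ↦ hH x.2

/-- **`MulEquiv` form in B3c's currency — THE SHAPE THE (C-γ3) ASSEMBLER CALLS**: `S ≤ ⟨g₁, g₂⟩` (commuting `g₁ g₂` in a plain
group `G`, e.g. `G = F_n ≃ₐ[K₀] F_n`, `S = Stab(w)`) and `e : ↥S ≃* D` (e.g. `SemiLocal.decompMulEquiv`, `D = (F_n)_w ≃ₐ[(K₀)_{w₀}] (F_n)_w`)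
⟹ `∃ σ τ : D, σ * τ = τ * σ ∧ ∀ g : D, ∃ i j : ℤ, g = σ ^ i * τ ^ j`. [folklore] -/
theorem exists_generators_of_mulEquiv_of_le {D : Type*} [Group D] {g₁ g₂ : G} (h12 : Commute g₁ g₂)
    (S : Subgroup G) (hS : S ≤ Subgroup.closure ({g₁, g₂} : Set G)) (e : S ≃* D) :
    ∃ σ τ : D, σ * τ = τ * σ ∧ ∀ g : D, ∃ i j : ℤ, g = σ ^ i * τ ^ j := by
  obtain ⟨σ, τ, hc, hcl⟩ := exists_closure_pair_eq_top_of_mulEquiv_of_le h12 S hS e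
  exact ⟨σ, τ, forall_exists_eq_zpow_mul_zpow_of_closure_pair_eq_top hc hcl⟩

/-- `ℕ`-exponent form of the consumer's binder in a finite group: `∀ g, ∃ a b : ℕ, g = σ ^ a * τ ^ b`. [folklore] -/
theorem forall_exists_eq_pow_mul_pow_of_closure_pair_eq_top {D : Type*} [Group D] [Finite D] {σ τ : D} (hc : Commute σ τ)
    (htop : Subgroup.closure ({σ, τ} : Set D) = ⊤) : ∀ g : D, ∃ a b : ℕ, g = σ ^ a * τ ^ b := fun g ↦ by
  obtain ⟨a, b, h⟩ := (mem_closure_pair_iff_of_commute_of_finite hc).1 (by rw [htop]; exact Subgroup.mem_top g)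
  exact ⟨a, b, h.symm⟩

/-- Conversely, B3c's binders give back `Subgroup.closure {σ, τ} = ⊤` (so the `⊤`-form lemmas of §5 apply to any pair handed
over in the consumer's currency). [folklore] -/
theorem closure_pair_eq_top_of_forall_exists_eq_zpow_mul_zpow {D : Type*} [Group D] {σ τ : D}
    (hgen : ∀ g : D, ∃ i j : ℤ, g = σ ^ i * τ ^ j) : Subgroup.closure ({σ, τ} : Set D) = ⊤ := by
  rw [eq_top_iff]
  intro g _
  obtain ⟨i, j, rfl⟩ := hgen g
  exact mul_mem (Subgroup.zpow_mem _ (Subgroup.subset_closure (by simp)) i)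
    (Subgroup.zpow_mem _ (Subgroup.subset_closure (by simp)) j)

/-! ### §4. Commutative ambient groups (`IsMulCommutative`, as in Mathlib's `IsAbelianGalois`) -/

/-- In a group with commutative multiplication (`IsMulCommutative`, the mixin of `IsAbelianGalois`), every subgroup inside
`⟨g₁, g₂⟩` is the closure of a commuting pair of its elements. [folklore] -/
theorem exists_closure_pair_eq_of_le_closure_pair_of_isMulCommutative [IsMulCommutative G] (g₁ g₂ : G)
    (H : Subgroup G) (hH : H ≤ Subgroup.closure ({g₁, g₂} : Set G)) :
    ∃ σ τ : G, σ ∈ H ∧ τ ∈ H ∧ Commute σ τ ∧ Subgroup.closure ({σ, τ} : Set G) = H :=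
  exists_closure_pair_eq_of_le_closure_pair (mul_comm' g₁ g₂) H hH

/-- In a group with commutative multiplication generated by `g₁, g₂` (e.g. `Gal(K̃_n/K) = ⟨γ̄₁, γ̄₂⟩`), every subgroup is, as a
group, generated by a commuting pair. [folklore] -/
theorem exists_closure_pair_eq_top_of_isMulCommutative [IsMulCommutative G] {g₁ g₂ : G}
    (htop : Subgroup.closure ({g₁, g₂} : Set G) = ⊤) (H : Subgroup G) :
    ∃ σ τ : H, Commute σ τ ∧ Subgroup.closure ({σ, τ} : Set H) = ⊤ :=
  exists_closure_pair_eq_top_of_closure_pair_eq_top (mul_comm' g₁ g₂) htop H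

/-- Injective-homomorphism form with a commutative target generated by `g₁, g₂`: any group `D` embedding into it is generated by a
commuting pair (`D = D_w`, target `Gal(F_n/K)` or `Gal(K̃_n/K)`). [folklore] -/
theorem exists_closure_pair_eq_top_of_injective_of_isMulCommutative {D : Type*} [Group D] [IsMulCommutative G]
    {g₁ g₂ : G} (htop : Subgroup.closure ({g₁, g₂} : Set G) = ⊤) (f : D →* G) (hf : Function.Injective f) :
    ∃ σ τ : D, Commute σ τ ∧ Subgroup.closure ({σ, τ} : Set D) = ⊤ :=
  exists_closure_pair_eq_top_of_injective (mul_comm' g₁ g₂) f hf fun x ↦ by rw [htop]; exact Subgroup.mem_top _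

/-- `MulEquiv` form in B3c's currency with a commutative ambient group (`[IsMulCommutative G]`, e.g. `F_n ≃ₐ[K₀] F_n` under
`IsAbelianGalois`): `S ≤ ⟨g₁, g₂⟩`, `e : ↥S ≃* D` ⟹ `∃ σ τ : D, σ * τ = τ * σ ∧ ∀ g, ∃ i j : ℤ, g = σ ^ i * τ ^ j`. [folklore] -/
theorem exists_generators_of_mulEquiv_of_le_of_isMulCommutative {D : Type*} [Group D] [IsMulCommutative G] (g₁ g₂ : G)
    (S : Subgroup G) (hS : S ≤ Subgroup.closure ({g₁, g₂} : Set G)) (e : S ≃* D) :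
    ∃ σ τ : D, σ * τ = τ * σ ∧ ∀ g : D, ∃ i j : ℤ, g = σ ^ i * τ ^ j :=
  exists_generators_of_mulEquiv_of_le (mul_comm' g₁ g₂) S hS e

/-! ### §5. Element forms for the generating pair (what the norm operators of the devissage consume) -/

/-- If `⟨σ, τ⟩ = ⊤` with `σ, τ` commuting, every element is `σ^m τ^n` (`m n : ℤ`). [folklore] -/
theorem exists_zpow_mul_zpow_eq_of_closure_pair_eq_top {σ τ : G} (hc : Commute σ τ)
    (htop : Subgroup.closure ({σ, τ} : Set G) = ⊤) (x : G) : ∃ m n : ℤ, σ ^ m * τ ^ n = x :=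
  (mem_closure_pair_iff_of_commute hc).1 (by rw [htop]; exact Subgroup.mem_top _)

/-- If `⟨σ, τ⟩ = ⊤` with `σ, τ` commuting in a finite group, every element is `σ^a τ^b` (`a b : ℕ`). [folklore] -/
theorem exists_pow_mul_pow_eq_of_closure_pair_eq_top [Finite G] {σ τ : G} (hc : Commute σ τ)
    (htop : Subgroup.closure ({σ, τ} : Set G) = ⊤) (x : G) : ∃ a b : ℕ, σ ^ a * τ ^ b = x :=
  (mem_closure_pair_iff_of_commute_of_finite hc).1 (by rw [htop]; exact Subgroup.mem_top _)

/-- If `⟨σ, τ⟩ = ⊤` with `σ, τ` commuting, the whole group is commutative (any two elements commute). [folklore] -/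
theorem commute_of_closure_pair_eq_top {σ τ : G} (hc : Commute σ τ)
    (htop : Subgroup.closure ({σ, τ} : Set G) = ⊤) (x y : G) : Commute x y :=
  commute_of_mem_closure_pair hc (by rw [htop]; exact Subgroup.mem_top _) (by rw [htop]; exact Subgroup.mem_top _)

/-- **`σ^{[G : ⟨τ⟩]} ∈ ⟨τ⟩`** for a finite group generated by a commuting pair `σ, τ` (so a `τ`-fixed vector is fixed by
`σ^{m₀}`, `m₀ = [G : ⟨τ⟩]` — the hypothesis `hσ` of the local devissage B1): `⟨τ⟩` is normal (the group is commutative) and the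
quotient has order `[G : ⟨τ⟩]`. [folklore] -/
theorem pow_index_mem_zpowers_of_closure_pair_eq_top [Finite G] {σ τ : G} (hc : Commute σ τ)
    (htop : Subgroup.closure ({σ, τ} : Set G) = ⊤) :
    σ ^ (Subgroup.zpowers τ).index ∈ Subgroup.zpowers τ := by
  haveI : (Subgroup.zpowers τ).Normal := by
    refine ⟨fun x hx g ↦ ?_⟩
    rw [(commute_of_closure_pair_eq_top hc htop g x).eq, mul_inv_cancel_right]
    exact hx
  rw [← QuotientGroup.eq_one_iff, QuotientGroup.mk_pow, Subgroup.index_eq_card, pow_card_eq_one']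

end Summit.BirchSwinnertonDyer.BirchSwinnertonDyer.Theorems.PrintCf2.LeopoldtAtV.TwoGenerated
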